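import Literature.AnabelianGeometry.SemiGraphs.TemperedSpecialFibreReductionsSchemaS3
import HarnessLib

/-!
# [SemiAnbd] Def. 2.2 (ii): morphisms of semi-graphs of anabelioids that are NOT isomorphisms
# (kernel witnesses for the structure predicate `ProfiniteSemiGraph.Hom.IsIso`)

Mochizuki, *Semi-graphs of anabelioids*, Publ. RIMS **42** (2006) [SemiAnbd], Def. 2.1 p. 22 (morphisms of
semi-graphs of anabelioids), Def. 2.2 (ii) p. 24 ("locally trivial", "isomorphism"), §1 p. 12
(sub-semi-graphs and their inclusions), Example 3.10 / Cor. 3.11 pp. 44–46 (the special-fibre carriers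
`G^c`). [cite: MochizukiSemiAnbd2006, Def 2.2(ii) p.24]

PROOF-ONLY file (abc-iut cell, layer L3, row «F-2559-NONISO-WITNESS» of `plan/L3/LF-SGA.tsv`, seat
abc-iut-L3-d3 gen 5; 0 definitions, no instance, no notation).  The cell's fact list carries the STRUCTURE
predicate `ProfiniteSemiGraph.Hom.IsIso` (abc-iut-L3-t2, `TemperedSpecialFibre.lean`) with the label
«universal-closure refuted / schema»; this file supplies the kernel witnesses behind that label:

* `ProfiniteSemiGraph.exists_hom_restrict_not_isIso` — for ANY semi-graph of anabelioids `𝒢` (local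
  presentation) and any sub-semi-graph `ℍ` missing an edge of `𝔾`, the inclusion `𝒢_ℍ → 𝒢` (identity
  constituent homomorphisms over abc-iut-L3-t1's `SemiGraph.Subgraph.ι`) is a LOCALLY TRIVIAL morphism that is
  NOT an isomorphism (it is not surjective on edges);
* `ProfiniteSemiGraph.exists_hom_base_id_not_isLocallyTrivial` — for ANY `𝒢` with a vertex whose group
  `Π_v` is non-trivial, the endomorphism over the identity of `𝔾` all of whose constituent homomorphisms are
  trivial is a morphism that is NOT locally trivial, hence not an isomorphism;
* `ProfiniteSemiGraph.Hom.not_forall_isIso` — the universal closure `∀ 𝒢 ℋ (F : 𝒢 → ℋ), F.IsIso` is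
  FALSE (universe `0`; instance: abc-iut-f-177's cusp graph `cuspGraph 2` and its edgeless sub-semi-graph);
* `exists_specialFibreData_hom_not_isIso` — at GENUINE special-fibre carriers (the consumer type
  `Hom Sα.Gc Sβ.Gc` of `Cor311`): over one tempered arithmetic group `D / ℚ_p` (abc-iut-f-106's
  `exists_padic_specialFibreModel`) the two special-fibre data "edgeless restriction" and "cusp graph" with
  the SAME tempered fundamental group admit an INHABITED non-isomorphism `Sα.Gc → Sβ.Gc` (the cusp-restoring
  inclusion); the tree's `TemperedSpecialFibreReductionsSchemaS3Cusps` records the opposite, vacuous,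
  direction (no morphism `cusp graph → restriction` at all).

A witness certifies only that the typed predicate is not universally inhabited; no statement of the paper
is touched.  Nothing here bears on [IUTchIII] Cor. 3.12.
-/

noncomputable section

open CategoryTheory Topology

namespace Literature.AnabelianGeometry.SemiGraphs

namespace ProfiniteSemiGraph

universe u

variable (𝒢 : ProfiniteSemiGraph.{u})

/-- **The inclusion of a proper sub-semi-graph is a locally trivial non-isomorphism.**  For a sub-semi-graph
`ℍ ⊆ 𝔾` and an edge `e ∉ ℍ`, the inclusion `𝒢_ℍ → 𝒢` — underlying morphism `ℍ ↪ 𝔾` (Def. 2.1 / §1 p. 12),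
identity homomorphisms on every constituent `Π_v`, `Π_e` — is a morphism of semi-graphs of anabelioids which
is locally trivial but not an isomorphism in the sense of Def. 2.2 (ii): it is not surjective on edges.
[cite: MochizukiSemiAnbd2006, Def 2.2(ii) p.24] -/
theorem exists_hom_restrict_not_isIso (H : 𝒢.graph.Subgraph) {e : 𝒢.graph.Edge} (he : e ∉ H.edges) :
    ∃ F : Hom (𝒢.restrict H) 𝒢, F.IsLocallyTrivial ∧ ¬ F.IsIso := by
  refine ⟨{ base := H.ι
            hV := fun v => ContinuousMonoidHom.id _
            hE := fun e => ContinuousMonoidHom.id _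
            comm := fun b v h => ⟨1, fun x => ?_⟩ }, ?_, ?_⟩
  · change (𝒢.brHom b.1 v.1 _ x : 𝒢.Gv v.1) = 1 * 𝒢.brHom b.1 v.1 _ x * 1⁻¹
    simp
  · exact ⟨fun v => Function.bijective_id, fun e => Function.bijective_id⟩
  · intro hF
    obtain ⟨e', he'⟩ := hF.bijective_edgeMap.2 e
    exact he (he' ▸ e'.2)

/-- **The endomorphism with trivial constituents is not locally trivial.**  For a vertex `v` with
non-trivial `Π_v`, the morphism `𝒢 → 𝒢` over the identity of `𝔾` all of whose constituent homomorphisms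
`Π_c → Π_c` are trivial (compatible with the `b_*` up to conjugation, trivially) is not locally trivial,
hence not an isomorphism (Def. 2.2 (ii)). [cite: MochizukiSemiAnbd2006, Def 2.2(ii) p.24] -/
theorem exists_hom_base_id_not_isLocallyTrivial (v : 𝒢.graph.Vertex) [Nontrivial (𝒢.Gv v)] :
    ∃ F : Hom 𝒢 𝒢, F.base = SemiGraph.Hom.id 𝒢.graph ∧ ¬ F.IsLocallyTrivial ∧ ¬ F.IsIso := by
  refine ⟨{ base := SemiGraph.Hom.id 𝒢.graph
            hV := fun _ => 1
            hE := fun _ => 1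
            comm := fun b w h => ⟨1, fun x => ?_⟩ }, rfl, ?_, ?_⟩
  · change (1 : 𝒢.Gv w) =
      1 * 𝒢.brHom b w h ((1 : 𝒢.Ge (𝒢.graph.edgeOf b) →ₜ* 𝒢.Ge (𝒢.graph.edgeOf b)) x) * 1⁻¹
    simp
  · rintro ⟨hV, -⟩
    obtain ⟨x, hx⟩ := exists_ne (1 : 𝒢.Gv v)
    obtain ⟨y, hy⟩ := (hV v).2 x
    exact hx (hy.symm.trans rfl)
  · rintro ⟨-, -, -, hV, -⟩
    obtain ⟨x, hx⟩ := exists_ne (1 : 𝒢.Gv v)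
    obtain ⟨y, hy⟩ := (hV v).2 x
    exact hx (hy.symm.trans rfl)

open IwahoriWitness in
/-- **The universal closure of `Hom.IsIso` is false** (universe `0`): not every morphism of semi-graphs
of anabelioids is an isomorphism — e.g. the inclusion of the edgeless sub-semi-graph of the cusp graph
`cuspGraph 2` (one vertex `ℤ_2 ⋊ (1 + 2ℤ_2)`, one cusp).  SCOPE: the refuted `∀` ranges over ALL
profinite semi-graphs `𝒢`, `ℋ` and ALL morphisms `F : 𝒢 → ℋ`; this refutes only the bare universal
closure of the STRUCTURE predicate `Hom.IsIso` (a definition, Def. 2.2 (ii)), which nobody asserts in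
print — the printed statements use "is an isomorphism" as a hypothesis or as a property of specific
constructed morphisms (e.g. Cor. 3.11). [cite: MochizukiSemiAnbd2006, Def 2.2(ii) p.24] -/
theorem Hom.not_forall_isIso : ¬ ∀ (𝒢 ℋ : ProfiniteSemiGraph.{0}) (F : Hom 𝒢 ℋ), F.IsIso := by
  intro h
  obtain ⟨F, -, hF⟩ :=
    exists_hom_restrict_not_isIso (cuspGraph 2) (cuspOmission 2) (e := PUnit.unit) (fun h => h)
  exact hF (h _ _ F)

end ProfiniteSemiGraph

/-! ### At genuine special-fibre carriers -/

open ProfiniteSemiGraph IwahoriWitness in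
/-- **A non-isomorphism between special-fibre carriers.**  Over ONE tempered arithmetic group `D / ℚ_p` there
are special-fibre data `Sα` (the edgeless restriction of the cusp graph) and `Sβ` (the cusp graph
`cuspGraph p`: vertex group `ℤ_p ⋊ (1 + pℤ_p)`, one cusp) with the same tempered fundamental group and the
same admissible quotient (`φ := id`), and a morphism `Sα.Gc → Sβ.Gc` — the cusp-restoring inclusion — which is locally
trivial but NOT an isomorphism of semi-graphs of anabelioids (Def. 2.2 (ii); the carriers of Ex. 3.10 /
Cor. 3.11). [cite: MochizukiSemiAnbd2006, Def 2.2(ii) p.24] -/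
theorem exists_specialFibreData_hom_not_isIso (p : ℕ) [Fact p.Prime] :
    ∃ (D : TemperedArithmeticGroup ℚ_[p]) (Sα Sβ : SpecialFibreData D) (φ : Sα.chart.G ≃ₜ* Sβ.chart.G)
      (F : Hom Sα.Gc Sβ.Gc),
      (∀ x : D.delta, φ (Sα.admissible x) = Sβ.admissible x) ∧ F.IsLocallyTrivial ∧ ¬ F.IsIso := by
  -- charts with a common tempered group: `π₁^temp` of the restriction, transported to the cusp graph
  obtain ⟨e⟩ := nonempty_btempCat_equivalence (cuspOmission_isCuspOmission p)
  let c₂ : TemperedPiChart ((cuspGraph p).restrict (cuspOmission p)) :=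
    ((cuspGraph p).restrict (cuspOmission p)).temperedPiChart (restrict_cuspOmission_prop36Hypotheses p)
  let c₁ : TemperedPiChart (cuspGraph p) := c₂.transport e
  -- one tempered arithmetic group over `ℚ_p` with `Δ ≅ π₁^temp`
  obtain ⟨D, -, -, ⟨ι⟩⟩ := TemperedArithmeticGroup.exists_padic_specialFibreModel p
    ((cuspGraph p).restrict (cuspOmission p)) (restrict_cuspOmission_thm37Hypotheses p) c₂
  let adm : D.delta →ₜ* c₂.G := ⟨ι.toMulEquiv.toMonoidHom, by exact map_continuous ι⟩
  have hadm : Function.Surjective adm := fun g => ⟨ι.symm g, ι.apply_symm_apply g⟩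
  let Sα : SpecialFibreData D :=
    { Gc := (cuspGraph p).restrict (cuspOmission p), hyp := restrict_cuspOmission_thm37Hypotheses p,
      chart := c₂, admissible := adm, admissible_surjective := hadm }
  let Sβ : SpecialFibreData D :=
    { Gc := cuspGraph p, hyp := cuspGraph_thm37Hypotheses p, chart := c₁, admissible := adm,
      admissible_surjective := hadm }
  obtain ⟨F, hlt, hF⟩ :=
    exists_hom_restrict_not_isIso (cuspGraph p) (cuspOmission p) (e := PUnit.unit) (fun h => h)
  exact ⟨D, Sα, Sβ, ContinuousMulEquiv.refl _, F, fun _ => rfl, hlt, hF⟩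

end Literature.AnabelianGeometry.SemiGraphs

end
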